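import Summits.BirchSwinnertonDyer.BirchSwinnertonDyer.Theorems.PrintX8VSCSharpFlatKatoUpperHalfContra
import Summits.BirchSwinnertonDyer.BirchSwinnertonDyer.Theorems.PrintX8VSCSharpFlatKatoDivisibilityContraOfThm134
import HarnessLib

/-!
# Corner X8 (`p = 3` good supersingular, `a₃ = ±3`), analytic rank `0`, ANY `3`-adic image: the UPPER half
# `ord₃ #Ш ≤ ord₃ #Ш_an` in PRINT keying WITHOUT the re-keyed named fact `thm716_sharpFlatCharIdeal_divisibility_contra` —
# Kato 2004 Thm. 13.4 (print-exact) + Serre's open image in its place (re-thread of p2 g4's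
# `PrintX8VSCSharpFlatKatoUpperHalfContra` through w3 g11's `thm716_contra_clauses_of_thm13_4`)

Cell `bsd-ssimc` (host), width seat `cruxlead-stmt-BirchSwinnertonDyer-19875-w3` (gen 11) under the LEAD of crux
stmt-BirchSwinnertonDyer-19875 `SprungLowerDivisibilityAtThree`; twin route `PrintX8VSC`. `--supports` stmt-BirchSwinnertonDyer-19875
`--as helper`; THEOREMS ONLY; closes NO item.

WHY. p2 g4's file proves, per X8 pair of analytic rank `0` and for ANY `3`-adic image, the Kato half `ξ ∣ L^{•₀}` and the
upper half `MissingUpperBoundAt W 3` modulo nine displayed named facts, one of which is the RE-KEYED transcription of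
Sprung 2012 Thm. 7.16 (`thm716_sharpFlatCharIdeal_divisibility_contra`, flags `Sp12-716-dual-action` / `Sp12-716-period`). Since
p681309 (`PrintX8VSCSharpFlatKatoDivisibilityContraOfThm134`) that fact is, ON X8, a kernel consequence of Kato 2004 Thm. 13.4
print-exact (`Kato2004.thm13_4_lengthAt_fineSelmerDualContra_le_of_isEulerSystemClass`), Serre's open image
(`serre_adicImage_contains_congruenceSubgroup`), the `γ⁻¹`-keyed package and the period unit (both already displayed here).
This file performs the consumer re-thread ONCE so the pen / referee can cite it: every statement below is p2 g4's with the
binder `h716c` replaced by `(h134C, hSerre)`; the proofs are p2 g4's token for token except that the two uses of Thm. 7.16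
(big image: clause (b); small image: clause (a) under `μ = 0`) are fed by `ChromaticCommonZeros.thm716_contra_clauses_of_thm13_4`
at the pair.

* §1 `sharpFlatUpper_dvd_of_muInvariant_eq_zero_of_rational` — p2 §1 as pure `Λ`-algebra: `char D.X = (ξ)`, `μ(D.X) = 0` and the
  per-datum RATIONAL clause `∃ n, pⁿ·L^• ∈ char D.X` give `ξ ∣ L^•` (Gauss' lemma); no named fact.
* §2 `X8.sharpFlatUpper_dvd_contra_of_hasUnitContent_of_thm13_4 (h714) (h134C) (hSerre) (hCKc) (h3)` — PER PAIR, ANY image: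
  for a colour of unit content and every `γ⁻¹`-keyed dual datum `D`, `char D.X = (ξ) ⟹ ξ ∣ L^•`.
* §3 `X8.missingUpperBoundAt_of_thm13_4_of_analyticRank_eq_zero (hmodf) (h22) (h714) (h134C) (hSerre) (hCKc) (h59) (h3) (hGZK) (hmod)`
  — **X8 ∧ `r_an = 0`, ANY image: `ord₃ #Ш ≤ ord₃ #Ш_an`**; corollaries `X8.bsdp_of_shaAn_le_of_thm13_4_…` (unit cells),
  `X8.bsdp_of_missingLowerBoundAt_of_thm13_4_…`; §4 CLASS forms `X8.upperHalf_rankZero_of_sharpFlatFactsContra_of_thm13_4`,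
  `X8.bsdp_rankZero_shaUnit_of_sharpFlatFactsContra_of_thm13_4`.

DISPLAYED named facts (ten names; `h22`, `h59` are tree theorems, displayed only to keep the file off the Theses cone, as in p2
g4): modularity `exists_isNewformOf`, entire continuation `hasEntireLFunction_rat`, Sprung 2012 Thm. 2.2, Thm. 7.14, the
`γ⁻¹`-keyed package `thm714seq_sharpFlatColemanKato_zeta_contra`, **Kato 2004 Thm. 13.4 print-exact, Serre's open image** (in
place of Thm. 7.16-contra), Sprung 2024 §5.2 all `N`, the period unit at `3`, GZK. HONEST STATUS: conditional on these
published facts (typed ≠ proved); THEOREM B enters as a kernel theorem; beyond print exactly as p2 g4 (the image-free INTEGRAL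
bound via THEOREM B + `μ`-transfer). No K1, no K′/C′, no main conjecture, no summit statement is proved; the leaf X8 and BSD
are NOT proved by any of this; 0 census cells move by class theorem.

References: [Sprung2012] Def. 6.1, Thm. 2.2, Def. 7.11, Thm. 7.14 with (3), Thm. 7.16 (pp. 1487–1504); [Kato2004Asterisque] Thm.
12.5, Thm. 13.4 (pp. 222, 226); [SerreAbelianLadic1968] IV-11; [Sprung2024] §5.2 Lemmas 5.5–5.9; [Sprung2017] Thm. 1.12;
[Wuthrich2014] Lemma 20; [GreenbergVatsal2000] p. 2, §3 Rem. 3.4; [Washington1997] §13.2; [Miller2011LMS] Def. 1.1; tree: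
`PrintX8VSCSharpFlatKatoUpperHalfContra` (p2 g4, p677545), `PrintX8VSCSharpFlatKatoDivisibilityContraOfThm134` (w3 g11, p681309).
-/

set_option autoImplicit false
-- justification: the mandated namespace `Summit.BirchSwinnertonDyer.BirchSwinnertonDyer.Theorems`
-- (single-conjunct summit, Sub = Summit) repeats a segment by design (D-0017).
set_option linter.dupNamespace false

noncomputable section

open scoped Classical NumberField MatrixGroups ModularForm

open NumberField IsDedekindDomain WeierstrassCurve CongruenceSubgroup Field
  Literature.NumberTheory.EllipticCurves Literature.NumberTheory.EllipticCurves.ModularForms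
  Literature.NumberTheory.EllipticCurves.Rank1Residual
  Literature.NumberTheory.EllipticCurves.Rank1Residual.Typed
  Literature.NumberTheory.EllipticCurves.Sprung2017 Literature.NumberTheory.EllipticCurves.Sprung2012
  Literature.NumberTheory.EllipticCurves.Sprung2024
  Literature.NumberTheory.EllipticCurves.GreenbergVatsal2000
  Literature.NumberTheory.EllipticCurves.ZpExtension
  Literature.NumberTheory.EllipticCurves.IwasawaAlgebra
  Literature.NumberTheory.EllipticCurves.Kato2004
  Summit.BirchSwinnertonDyer.BirchSwinnertonDyer.Theorems
  Summit.BirchSwinnertonDyer.BirchSwinnertonDyer.Theorems.X8KatoUpperHalfContra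
  Summit.BirchSwinnertonDyer.Rank1Residual.Supersingular
  Summit.BirchSwinnertonDyer.Rank1Residual.X1.MuLambda

namespace Summit.BirchSwinnertonDyer.BirchSwinnertonDyer.Theorems.X8KatoUpperHalfContraOfThm134

/-! ### §1 Λ-algebra: the per-datum rational clause is INTEGRAL when `μ = 0` (no named fact) -/

/-- **`μ(X) = 0` makes a rational Kato divisibility integral** (pure `Λ`-algebra, p2 g4's §1 with the fact replaced by its
per-datum conclusion): for a finitely generated torsion `Λ`-module `X` with `char X = (ξ)`, `μ(X) = 0`, and an `L ∈ Λ` with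
`pⁿ·L ∈ char X` for some `n`: **`ξ ∣ L`** (`ξ` has unit content by Greenberg–Vatsal (2); Gauss' lemma for the prime `p ∈ Λ`).
[cite: GreenbergVatsal2000, p. 2, (1)–(2)] [cite: Washington1997, §7.1 and §13.2] -/
theorem sharpFlatUpper_dvd_of_muInvariant_eq_zero_of_rational {p : ℕ} [Fact p.Prime]
    {X : Type*} [AddCommGroup X] [Module (IwasawaAlgebra p) X] [Module.Finite (IwasawaAlgebra p) X]
    (hX : Module.IsTorsion (IwasawaAlgebra p) X) {ξ L : IwasawaAlgebra p}
    (hξ : Module.charIdeal (IwasawaAlgebra p) X = Ideal.span {ξ}) (hμ : muInvariant p X = 0)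
    (hrat : ∃ n : ℕ, (p : IwasawaAlgebra p) ^ n * L ∈ Module.charIdeal (IwasawaAlgebra p) X) : ξ ∣ L := by
  have hu : HasUnitContent ξ := (muInvariant_eq_zero_iff_hasUnitContent X hX hξ).mp hμ
  obtain ⟨n, hn⟩ := hrat
  rw [hξ, Ideal.mem_span_singleton] at hn
  have hC : ((p : IwasawaAlgebra p) ^ n : IwasawaAlgebra p) = PowerSeries.C ((p : ℤ_[p]) ^ n) := by
    rw [map_pow, map_natCast]
  rw [hC] at hn
  exact Summit.BirchSwinnertonDyer.Rank1Residual.Additive.dvd_of_dvd_C_pow_mul_of_hasUnitContent hu n hn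

/-! ### §2 PER PAIR, ANY image, print keying: a colour of UNIT CONTENT has the INTEGRAL Kato half, from Kato 13.4 -/

section KatoHalf

variable (W : WeierstrassCurve ℚ) [W.IsElliptic] [W.IsGloballyMinimal] (p : ℕ) [Fact p.Prime]

/-- **X8, ANY `3`-adic image, PRINT keying: for a colour `•` of UNIT CONTENT, `ξ ∣ L^•` INTEGRALLY for EVERY contragredient dual
datum `D` of `Sel^•(E/ℚ_∞)` (`char D.X = (ξ)`) — p2 g4's `X8.sharpFlatUpper_dvd_contra_of_hasUnitContent` with Thm. 7.16-contra
REPLACED by Kato 13.4 print-exact (`h134C`) + Serre (`hSerre`).** Same binders otherwise (Thm. 7.14 `h714` at key `γ`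
transported by the `ι`-dictionary; package `hCKc`; period unit `h3`). Split on the image exactly as p2 g4: `surj(3)` ⟹ tower
surjectivity (Wuthrich 2014 Lemma 20, kernel) ⟹ clause (b) of `thm716_contra_clauses_of_thm13_4` (Kato 13.4 (3), the
transvection); `¬ surj(3)` ⟹ `μ(D.X) ≤ μ(Λ/(L^•)) = 0` (w2's contragredient `μ`-transfer) and clause (a) (Kato 13.4 (2), Serre)
through §1. PER PAIR; conditional on the five named facts; closes nothing.
[cite: Sprung2012, Def. 6.1 (p. 1495), Def. 7.11 (p. 1503), Thm. 7.14 with (3), Thm. 7.16 (p. 1504)]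
[cite: Kato2004Asterisque, Thm. 12.5 (4) and (12.5.2) (p. 222), Thm. 13.4 (2)(3) (p. 226)] [cite: Wuthrich2014, Lemma 20 (p. 399)]
[cite: SerreAbelianLadic1968, IV-11] [cite: GreenbergVatsal2000, p. 2 (1)–(2) and §3 Remark 3.4] -/
theorem X8.sharpFlatUpper_dvd_contra_of_hasUnitContent_of_thm13_4
    (h714 : thm714_sharpFlatSelmerDual_finite_torsion)
    (h134C : thm13_4_lengthAt_fineSelmerDualContra_le_of_isEulerSystemClass)
    (hSerre : serre_adicImage_contains_congruenceSubgroup)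
    (hCKc : thm714seq_sharpFlatColemanKato_zeta_contra) (h3 : realPeriodRat_eq_unit_mul_plusPeriod_three)
    (hX : ClassX8 W p)
    {κ : ZpExtension ℚ p} {γ : absoluteGaloisGroup ℚ} (hκ : κ.IsCyclotomic)
    (hγ : κ.IsTopGenerator γ) (hγ' : IsCyclotomicVariable p γ)
    {v : HeightOneSpectrum (𝓞 ℚ)} (hv : (p : 𝓞 ℚ) ∈ v.asIdeal)
    {g : absoluteGaloisGroup (v.adicCompletion ℚ)}
    (hg : κ.IsTopGenerator (resGalOfEmb (closureEmb (K := ℚ) (v.adicCompletion ℚ)) g))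
    {cneg : localPoints W (v.adicCompletion ℚ)} {c : ℕ → localPoints W (v.adicCompletion ℚ)}
    (hc : IsHondaSystem κ (closureEmb (K := ℚ) (v.adicCompletion ℚ)) W (W.frobeniusTrace p) g cneg c)
    {N : ℕ} [NeZero N] {f : CuspForm (Gamma0 N) 2} (hf : IsNewformOf W f)
    {Lsharp Lflat : IwasawaAlgebra p} (hSP : IsSprungPair f p (W.frobeniusTrace p) Lsharp Lflat)
    (col : Chroma) (hu : HasUnitContent (chromaticL col Lsharp Lflat))
    (D : SharpFlatSelmerDualData W κ γ⁻¹ (closureEmb (K := ℚ) (v.adicCompletion ℚ))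
      (W.frobeniusTrace p) g c col)
    {ξ : IwasawaAlgebra p} (hξ : D.charIdeal = Ideal.span {ξ}) : ξ ∣ chromaticL col Lsharp Lflat := by
  have hp3 : p = 3 := hX.1
  subst hp3
  have hp2 : (3 : ℕ) ≠ 2 := by decide
  have hgood : W.HasGoodReductionAtPrime 3 := hX.2.1.1
  have hdvd : ((3 : ℕ) : ℤ) ∣ W.frobeniusTrace 3 := hX.2.1.2
  have hirr : W.HasIrreducibleModPGaloisRep 3 := ClassX8.irr W 3 hX
  have hcol : chromaticL col Lsharp Lflat ≠ 0 :=
    Summit.BirchSwinnertonDyer.Rank1Residual.X11a.ne_zero_of_hasUnitContent hu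
  -- Thm. 7.14 AT KEY `γ` on the real tree-keyed dual, transported to the print-keyed `D` by the `ι`-dictionary
  let D₀ := sharpFlatSelmerDualData W κ (closureEmb (K := ℚ) (v.adicCompletion ℚ))
    (W.frobeniusTrace 3) g c col hγ
  obtain ⟨hfin₀, htor₀⟩ :=
    h714 W 3 hp2 hgood hdvd f hf κ γ hκ hγ hγ' v hv g hg cneg c hc col Lsharp Lflat hSP hcol D₀
  haveI := hfin₀
  haveI : Module.Finite (IwasawaAlgebra 3) D.X := (sharpFlatSelmerDualData_finite_inv_iff D₀ D).1 hfin₀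
  have htor : Module.IsTorsion (IwasawaAlgebra 3) D.X := (sharpFlatSelmerDualData_isTorsion_inv_iff D₀ D).1 htor₀
  -- a `3`-adic unit period ratio `ϖ = u⁻¹` for `f` (the held period fact at `3`)
  obtain ⟨u, hu1, hΩ⟩ := h3 W hgood hirr f hf
  have hu0 : (u : ℝ) ≠ 0 := by
    intro h
    have h0' : u = 0 := by exact_mod_cast h
    rw [h0'] at hu1
    simp at hu1
  have hϖ : ((u⁻¹ : ℚ) : ℝ) * W.realPeriodRat = plusPeriod f := by
    rw [hΩ, Rat.cast_inv, ← mul_assoc, inv_mul_cancel₀ hu0, one_mul]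
  have hϖ1 : ‖((u⁻¹ : ℚ) : ℚ_[3])‖ = 1 := by
    rw [Rat.cast_inv, norm_inv, hu1, inv_one]
  -- Sprung Thm. 7.16-contra AT THE PAIR, both clauses, from Kato 13.4 + Serre + the package (w3 g11)
  have h716 := ChromaticCommonZeros.thm716_contra_clauses_of_thm13_4 h134C hSerre hCKc W 3 hp2 hgood hdvd
    (ClassX8.not_hasCM W 3 hX) (ClassX8.irr' W 3 hX) f hf u⁻¹ hϖ hϖ1 κ γ hκ hγ hγ' v hv g hg cneg c hc col
    Lsharp Lflat hSP hcol D htor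
  by_cases hs : Surj W 3
  · -- big image: `3`-adic surjectivity (Wuthrich 2014 Lemma 20) and clause (b)
    have hsurj : ∀ n : ℕ, W.HasSurjectiveModNGaloisRep (3 ^ n : ℕ) :=
      surjective_pow_of_surj_of_good W 3 Wuthrich2014.lemma20_surjective_threeAdic_of_semistable_holds
        hp2 hgood hs
    have hmem := h716.2 hsurj
    rw [hξ] at hmem
    exact Ideal.mem_span_singleton.mp hmem
  · -- small image: `μ(D.X) ≤ μ(Λ/(L^•)) = 0` by the contragredient `μ`-transfer, then clause (a) through §1
    have hμL : muInvariant 3 (IwasawaAlgebra 3 ⧸ Ideal.span {chromaticL col Lsharp Lflat}) = 0 :=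
      (PrintX8SharpFlatMuTransfer.muInvariant_quotient_span_eq_zero_iff_hasUnitContent hcol).mpr hu
    have hμ : muInvariant 3 D.X = 0 :=
      Nat.le_zero.mp ((X8MainConjectureContra.X8.sharpFlatMu_le_of_oneColour_hasUnitContent_contra W 3 hCKc h3
        hX hs f hf u⁻¹ hϖ κ γ hκ hγ hγ' v hv g hg cneg c hc hSP col hu col hcol D).trans hμL.le)
    exact sharpFlatUpper_dvd_of_muInvariant_eq_zero_of_rational htor hξ hμ h716.1

end KatoHalf

/-! ### §3 X8 ∧ `r_an = 0`, ANY image, print keying: the UPPER half `ord₃ #Ш ≤ ord₃ #Ш_an` from Kato 13.4; unit cells -/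

section RankZero

variable (W : WeierstrassCurve ℚ) [W.IsElliptic] [W.IsGloballyMinimal] (p : ℕ) [Fact p.Prime]

/-- **X8 ∧ `r_an = 0`, ANY `3`-adic image, PRINT keying: `ord₃ #Ш ≤ ord₃ #Ш_an` WITHOUT Thm. 7.16-contra** — p2 g4's
`X8.missingUpperBoundAt_of_sharpFlatKatoContra_of_analyticRank_eq_zero` with `h716c` replaced by Kato 13.4 print-exact (`h134C`) +
Serre (`hSerre`); proof token for token, §2 of this file in place of p2's §2. Displayed: `hmodf`, `h22` (tree theorem), `h714`,
`h134C`, `hSerre`, `hCKc`, `h59` (tree theorem), `h3`, `hGZK`, `hmod`. PER PAIR; conditional; closes nothing.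
[cite: Sprung2012, Thm. 2.2 (p. 1487), Prop. 6.14, Def. 7.11, Thm. 7.14 with (3), Thm. 7.16 (p. 1504), §7.5]
[cite: Sprung2024, §5.2 Lemmas 5.5–5.9 and Proof of Thm. 5.3 (pp. 39–41)] [cite: Sprung2017, Thm. 1.12 and Cor. 4.11]
[cite: Kato2004Asterisque, Thm. 12.5 and Thm. 12.6 (p. 222), Thm. 13.4 (p. 226)] [cite: GreenbergLNM1716, §1 (p. 60)]
[cite: MazurTateTeitelbaum1986Invent, Ch. I §17] [cite: Pollack2003, Def. 6.15] [cite: Miller2011LMS, Def. 1.1] -/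
theorem X8.missingUpperBoundAt_of_thm13_4_of_analyticRank_eq_zero
    (hmodf : exists_isNewformOf) (h22 : thm22_exists_isHondaSystem)
    (h714 : thm714_sharpFlatSelmerDual_finite_torsion)
    (h134C : thm13_4_lengthAt_fineSelmerDualContra_le_of_isEulerSystemClass)
    (hSerre : serre_adicImage_contains_congruenceSubgroup)
    (hCKc : thm714seq_sharpFlatColemanKato_zeta_contra)
    (h59 : lem59AllN_sharpFlatCharValue_rankZero)
    (h3 : realPeriodRat_eq_unit_mul_plusPeriod_three)
    (hGZK : rank_eq_analyticRank_of_analyticRank_le_one) (hmod : hasEntireLFunction_rat)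
    (hX : ClassX8 W p) (h0 : W.analyticRank = 0) : MissingUpperBoundAt W p := by
  have hp3 : p = 3 := hX.1
  subst hp3
  have hp2 : (3 : ℕ) ≠ 2 := by decide
  have hgood : W.HasGoodReductionAtPrime 3 := hX.2.1.1
  have hdvd : ((3 : ℕ) : ℤ) ∣ W.frobeniusTrace 3 := hX.2.1.2
  have hirr : W.HasIrreducibleModPGaloisRep 3 := ClassX8.irr W 3 hX
  have hL : W.entireLFunction 1 ≠ 0 := (W.analyticRank_eq_zero_iff_holds (hmod W)).1 h0
  -- the newform (modularity) and Sprung's pair (Sprung 2017 Thm. 1.12)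
  haveI : NeZero (W.conductorNorm ℤ) := ⟨(W.conductorNorm_pos_holds).ne'⟩
  obtain ⟨f, hf⟩ := hmodf W
  obtain ⟨Lsharp, Lflat, hSP⟩ :=
    thm112_exists_isSprungPair_holds (W := W) (f := f) (p := 3) hp2 hf hgood hdvd
  -- THEOREM B (input-free): a colour `•₀` with `L^{•₀} ≠ 0` of unit content
  obtain ⟨col, hcol, -, hu, -⟩ :=
    PrintX8VSOneColourMuAnX8.ClassX8.oneColourMuAn W 3 hX _ inferInstance f Lsharp Lflat hf hSP
  -- the cyclotomic setting, the place above `3`, the local lift, a Honda system (Thm. 2.2)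
  obtain ⟨κ, hκ, γ, hγ, hγ'⟩ := exists_isCyclotomic_isTopGenerator_isCyclotomicVariable_holds 3
  obtain ⟨v, hv⟩ :=
    Literature.NumberTheory.NumberFields.RingOfIntegers.exists_heightOneSpectrum_natCast_mem ℚ
      (p := 3) (by norm_num)
  obtain ⟨g, hg⟩ := hκ.exists_isTopGenerator_resGalOfEmb_adicCompletion v hv
  obtain ⟨cneg, c, hc⟩ := h22 W 3 hp2 hgood hdvd κ γ hκ hγ hγ' v hv g hg
  -- the real tree-keyed dual `D₀` (key `γ`, Thm. 7.14 there) and a PRINT-keyed dual `D` (key `γ⁻¹`) of `Sel^{•₀}`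
  let D₀ := sharpFlatSelmerDualData W κ (closureEmb (K := ℚ) (v.adicCompletion ℚ))
    (W.frobeniusTrace 3) g c col hγ
  obtain ⟨hfin₀, htor₀⟩ :=
    h714 W 3 hp2 hgood hdvd f hf κ γ hκ hγ hγ' v hv g hg cneg c hc col Lsharp Lflat hSP hcol D₀
  haveI := hfin₀
  obtain ⟨D⟩ := nonempty_sharpFlatSelmerDualData_rat W κ γ⁻¹ v g c col
  haveI : Module.Finite (IwasawaAlgebra 3) D.X := (sharpFlatSelmerDualData_finite_inv_iff D₀ D).1 hfin₀
  obtain ⟨gen, hgen⟩ := (charIdeal_isPrincipal_holds 3 D.X).principal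
  have hchar : D.charIdeal = Ideal.span {gen} := hgen
  -- (K•) AT KEY `γ` for `ι gen` (Sprung 2024 Lemmas 5.5–5.9, all levels), moved to `gen` by `(ι gen)(0) = gen(0)`
  have hchar₀ : D₀.charIdeal = Ideal.span {invol 3 gen} :=
    X8MainConjectureRoadContra.charIdeal_eq_span_invol_of_inv D₀ D hchar
  have hK₀ : (⟨invol 3 gen, 0, 0⟩ : SignedDatum W 3).EulerCharacteristic := fun hfin =>
    h59 W 3 hp2 hgood hdvd hL κ γ hκ hγ hγ' v hv g hg cneg c hc col D₀ htor₀ (invol 3 gen) hchar₀ hfin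
  have hK : (⟨gen, 0, 0⟩ : SignedDatum W 3).EulerCharacteristic := by
    intro hfin
    obtain ⟨w, hw⟩ := hK₀ hfin
    refine ⟨w, ?_⟩
    change ((PowerSeries.constantCoeff (invol 3 gen) : ℤ_[3]) : ℚ_[3]) = _ at hw
    change ((PowerSeries.constantCoeff gen : ℤ_[3]) : ℚ_[3]) = _
    rw [IwasawaAlgebra.constantCoeff_invol] at hw
    exact hw
  -- §2: Kato 13.4 through the ♯/♭ Coleman maps, PRINT keying, INTEGRAL on all of X8 for the unit-content colour
  have hKato : gen ∣ chromaticL col Lsharp Lflat :=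
    X8.sharpFlatUpper_dvd_contra_of_hasUnitContent_of_thm13_4 W 3 h714 h134C hSerre hCKc h3 hX hκ hγ hγ' hv hg hc
      hf hSP col hu D hchar
  exact missingUpperBoundAt_of_chromaticUpperDivisibility W 3 hGZK hp2 hgood hirr hL hf
    (h3 W hgood hirr f hf) hSP col (ClassX8.not_dvd_chromaticConst' W 3 hX col) gen hK hKato

/-- **UNIT CELLS, X8 ∧ `r_an = 0`, ANY image, PRINT keying, WITHOUT Thm. 7.16-contra: `ord₃ #Ш_an ≤ 0 ⟹ BSD(E,3)`** (p2 g4's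
corollary re-threaded; 54 of the 142 rank-`0` census cells, all `C_ns⁺(3)`). PER PAIR; conditional; closes nothing.
[cite: Sprung2012, Thm. 7.14 and Thm. 7.16 (p. 1504)] [cite: Kato2004Asterisque, Thm. 13.4 (p. 226)] [cite: Miller2011LMS, §1 and Def. 1.1] -/
theorem X8.bsdp_of_shaAn_le_of_thm13_4_of_analyticRank_eq_zero
    (hmodf : exists_isNewformOf) (h22 : thm22_exists_isHondaSystem)
    (h714 : thm714_sharpFlatSelmerDual_finite_torsion)
    (h134C : thm13_4_lengthAt_fineSelmerDualContra_le_of_isEulerSystemClass)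
    (hSerre : serre_adicImage_contains_congruenceSubgroup)
    (hCKc : thm714seq_sharpFlatColemanKato_zeta_contra)
    (h59 : lem59AllN_sharpFlatCharValue_rankZero)
    (h3 : realPeriodRat_eq_unit_mul_plusPeriod_three)
    (hGZK : rank_eq_analyticRank_of_analyticRank_le_one) (hmod : hasEntireLFunction_rat)
    (hX : ClassX8 W p) (h0 : W.analyticRank = 0)
    (hsha : ∃ q : ℚ, shaAn W = (q : ℂ) ∧ padicValRat p q ≤ 0) : BSDp W p := by
  refine bsdp_of_missingPPartAt W p hGZK (by omega) (missingPPartAt_of_lower_of_upper W p ?_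
    (X8.missingUpperBoundAt_of_thm13_4_of_analyticRank_eq_zero W p hmodf h22 h714 h134C hSerre hCKc h59 h3
      hGZK hmod hX h0))
  obtain ⟨q, hq, hle⟩ := hsha
  exact ⟨q, hq, hle.trans (by exact_mod_cast Nat.zero_le _)⟩

/-- **X8 ∧ `r_an = 0`, ANY image, PRINT keying, WITHOUT Thm. 7.16-contra, LOWER half displayed ⟹ `BSD(E,3)`** (p2 g4's corollary
re-threaded: the residual beyond the displayed prints on a rank-`0` X8 pair is EXACTLY `MissingLowerBoundAt W 3`). PER PAIR;
conditional; closes nothing. [cite: Sprung2012, Thm. 7.16 (p. 1504)] [cite: Kato2004Asterisque, Thm. 13.4 (p. 226)]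
[cite: Miller2011LMS, §1 and Def. 1.1] -/
theorem X8.bsdp_of_missingLowerBoundAt_of_thm13_4_of_analyticRank_eq_zero
    (hmodf : exists_isNewformOf) (h22 : thm22_exists_isHondaSystem)
    (h714 : thm714_sharpFlatSelmerDual_finite_torsion)
    (h134C : thm13_4_lengthAt_fineSelmerDualContra_le_of_isEulerSystemClass)
    (hSerre : serre_adicImage_contains_congruenceSubgroup)
    (hCKc : thm714seq_sharpFlatColemanKato_zeta_contra)
    (h59 : lem59AllN_sharpFlatCharValue_rankZero)
    (h3 : realPeriodRat_eq_unit_mul_plusPeriod_three)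
    (hGZK : rank_eq_analyticRank_of_analyticRank_le_one) (hmod : hasEntireLFunction_rat)
    (hX : ClassX8 W p) (h0 : W.analyticRank = 0) (hlow : MissingLowerBoundAt W p) : BSDp W p :=
  bsdp_of_missingPPartAt W p hGZK (by omega) (missingPPartAt_of_lower_of_upper W p hlow
    (X8.missingUpperBoundAt_of_thm13_4_of_analyticRank_eq_zero W p hmodf h22 h714 h134C hSerre hCKc h59 h3
      hGZK hmod hX h0))

end RankZero

/-! ### §4 CLASS forms on X8 ∩ {r_an = 0} (ANY image), print keying, without Thm. 7.16-contra -/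

/-- **CLASS form: the upper half on ALL of X8 ∩ {r_an = 0}, ANY `3`-adic image, PRINT keying, modulo ten displayed named facts
with Kato 13.4 + Serre in place of Thm. 7.16-contra** (p2 g4's `X8.upperHalf_rankZero_of_sharpFlatFactsContra`, re-threaded).
[cite: Sprung2012, Thm. 2.2, Thm. 7.14 and Thm. 7.16 (p. 1504)] [cite: Kato2004Asterisque, Thm. 13.4 (p. 226)]
[cite: Sprung2024, §5.2 Lemmas 5.5–5.9] [cite: Pollack2003, Def. 6.15] -/
theorem X8.upperHalf_rankZero_of_sharpFlatFactsContra_of_thm13_4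
    (hmodf : exists_isNewformOf) (h22 : thm22_exists_isHondaSystem)
    (h714 : thm714_sharpFlatSelmerDual_finite_torsion)
    (h134C : thm13_4_lengthAt_fineSelmerDualContra_le_of_isEulerSystemClass)
    (hSerre : serre_adicImage_contains_congruenceSubgroup)
    (hCKc : thm714seq_sharpFlatColemanKato_zeta_contra)
    (h59 : lem59AllN_sharpFlatCharValue_rankZero)
    (h3 : realPeriodRat_eq_unit_mul_plusPeriod_three)
    (hGZK : rank_eq_analyticRank_of_analyticRank_le_one) (hmod : hasEntireLFunction_rat) :
    ∀ (W : WeierstrassCurve ℚ) [W.IsElliptic] [W.IsGloballyMinimal] (p : ℕ) [Fact p.Prime],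
      ClassX8 W p → W.analyticRank = 0 → MissingUpperBoundAt W p :=
  fun W _ _ p _ hX h0 ↦
    X8.missingUpperBoundAt_of_thm13_4_of_analyticRank_eq_zero W p hmodf h22 h714 h134C hSerre hCKc h59 h3 hGZK
      hmod hX h0

/-- **CLASS form, unit cells: on ALL of X8 ∩ {r_an = 0} ∩ {ord₃ #Ш_an ≤ 0}, ANY image, `BSD(E,3)`** modulo the ten displayed named
facts (Kato 13.4 + Serre in place of Thm. 7.16-contra). [cite: Sprung2012, Thm. 7.14 and Thm. 7.16 (p. 1504)]
[cite: Kato2004Asterisque, Thm. 13.4 (p. 226)] [cite: Miller2011LMS, §1 and Def. 1.1] -/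
theorem X8.bsdp_rankZero_shaUnit_of_sharpFlatFactsContra_of_thm13_4
    (hmodf : exists_isNewformOf) (h22 : thm22_exists_isHondaSystem)
    (h714 : thm714_sharpFlatSelmerDual_finite_torsion)
    (h134C : thm13_4_lengthAt_fineSelmerDualContra_le_of_isEulerSystemClass)
    (hSerre : serre_adicImage_contains_congruenceSubgroup)
    (hCKc : thm714seq_sharpFlatColemanKato_zeta_contra)
    (h59 : lem59AllN_sharpFlatCharValue_rankZero)
    (h3 : realPeriodRat_eq_unit_mul_plusPeriod_three)
    (hGZK : rank_eq_analyticRank_of_analyticRank_le_one) (hmod : hasEntireLFunction_rat) :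
    ∀ (W : WeierstrassCurve ℚ) [W.IsElliptic] [W.IsGloballyMinimal] (p : ℕ) [Fact p.Prime],
      ClassX8 W p → W.analyticRank = 0 → (∃ q : ℚ, shaAn W = (q : ℂ) ∧ padicValRat p q ≤ 0) → BSDp W p :=
  fun W _ _ p _ hX h0 hsha ↦
    X8.bsdp_of_shaAn_le_of_thm13_4_of_analyticRank_eq_zero W p hmodf h22 h714 h134C hSerre hCKc h59 h3 hGZK
      hmod hX h0 hsha

end Summit.BirchSwinnertonDyer.BirchSwinnertonDyer.Theorems.X8KatoUpperHalfContraOfThm134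

end
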